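import Mathlib
import HarnessLib
import Summits.HubbardSuperconductivity.HubbardSuperconductivity.Theorems.KLProgrammeKLRegimeTwoVolumeSourceSmoothDefs
import Literature.MathematicalPhysics.QuantumLattice.SectorisedKernelNormExtraction

/-!
# Route `KLProgramme` — crux K3, VL child (stmt-HubbardSuperconductivity-20440), keying option «(VL)-SRC-WINDOW»: THE SMOOTHING IS THE WINDOW MULTIPLIER
# ON THE PLAIN ANALYSIS — `srcSmoothMat · klSrcAnalysisAt = klSrcAnalysisAtW` (seat hubbard-kl-k3c4-p1 g16, filed by g17 under the pen's (R235) «KEY = WINDOW»)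

The plane waves are eigenvectors of the time convolution: `Σ_{τ″} W_c(τ,τ″)·e^{−is_c k·(τ″,x⃗)} = w_{k₀}·e^{−is_c k·(τ,x⃗)}` (orthogonality in imaginary time,
`Literature…SectorisedKernelNormExtraction.sum_imagTime_cexp`), hence the smoothing endomorphism applied AFTER the doubled analysis equals the doubled
analysis with the window family `F_χ` (`srcWindowFamily`) in the source copy: the objects of the window key are the plain objects read through
`E(F_χ)`, whose `4M`-grid source block has `M`-uniform rows (p3 g18 `…TowerBaseSrcWindowRows.windowBlock_wtRows_le`).

* `srcSmoothPhase_eq_freq_mul_time`, **`sum_srcSmoothKernel_mul_hubbardPlaneWave`**, **`srcSmoothMat_mul_klSrcAnalysisAt`**, `srcSmooth_klSrcActionAt`.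

Proofs only.  [cite: Salmhofer1999, App. B.5.5]
-/

noncomputable section

namespace Summit.HubbardSuperconductivity.HubbardSuperconductivity.Theorems.TwoVolumeSource

set_option linter.dupNamespace false -- summit = problem name (single-conjunct summit), D-0017

open Finset Complex Literature.MathematicalPhysics.QuantumLattice Literature.Probability.LatticeModels GrassmannAlgebra
open Summit.HubbardSuperconductivity.HubbardSuperconductivity.Theorems.KLRegimeSplit
open Summit.HubbardSuperconductivity.HubbardSuperconductivity.Theorems.KLProgrammeLegKernels
open scoped Real

variable {V M : ℕ} [NeZero V] [NeZero M]

omit [NeZero V] [NeZero M] in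
/-- In `Fin 2`, `s ≠ 0 ⇒ s = 1` (local copy). [folklore] -/
theorem fin_two_eq_one_of_ne_zero' {s : Fin 2} (h : ¬ s = 0) : s = 1 := by
  rcases Fin.exists_fin_two.mp ⟨s, rfl⟩ with h0 | h1
  · exact absurd h0 h
  · exact h1

omit [NeZero V] [NeZero M] in
/-- Source rows of `S` (local copy of `srcSmoothMat_apply_of_src`). -/
theorem srcSmoothMat_apply_of_src' (n : ℕ) (p' q' : SrcLabel V M n) (h1' : p'.2 = 1) (hq1 : q'.2 = 1) :
    srcSmoothMat V M n p' q' = if p'.1.1.2 = q'.1.1.2 ∧ p'.1.2 = q'.1.2 then srcSmoothKernel M p'.1.2.2 p'.1.1.1 q'.1.1.1 else 0 := by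
  rw [srcSmoothMat_apply, if_neg (show ¬(p'.2 = 0 ∧ q'.2 = 0) from fun h => absurd (h1'.symm.trans h.1) (by decide)),
    if_pos (show p'.2 = 1 ∧ q'.2 = 1 from ⟨h1', hq1⟩)]

omit [NeZero V] [NeZero M] in
/-- `S a X = [a = X]` for alive `a` (local copy). -/
theorem srcSmoothMat_apply_of_alive' {n : ℕ} (a X : SrcLabel V M n) (ha : a.2 = 0) : srcSmoothMat V M n a X = if a = X then 1 else 0 := by
  rw [srcSmoothMat_apply]
  by_cases hX : X.2 = 0
  · rw [if_pos ⟨ha, hX⟩]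
    by_cases h : a = X
    · rw [if_pos h, if_pos (congrArg Prod.fst h)]
    · have h1 : a.1 ≠ X.1 := fun h1 => h (Prod.ext h1 (ha.trans hX.symm))
      rw [if_neg h1, if_neg h]
  · have h01 : ¬(a.2 = 0 ∧ X.2 = 0) := fun h => hX h.2
    have h11 : ¬(a.2 = 1 ∧ X.2 = 1) := fun h => absurd (ha.symm.trans h.1) (by decide)
    have hne : a ≠ X := fun h => hX (h ▸ ha)
    rw [if_neg h01, if_neg h11, if_neg hne]

omit [NeZero V] [NeZero M] in
/-- The `β`-free phase is `ω_j t_τ − ω_j t_{τ″}` for `β ≠ 0`. [folklore] -/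
theorem srcSmoothPhase_eq_freq_mul_time {β : ℝ} (hβ : β ≠ 0) (j : MatsubaraIdx M) (τ τ' : ImagTimeIdx M) :
    srcSmoothPhase M j τ τ' = matsubaraFreq β M j * imagTime β M τ - matsubaraFreq β M j * imagTime β M τ' := by
  unfold srcSmoothPhase matsubaraFreq imagTime
  rcases Nat.eq_zero_or_pos M with hM | hM
  · exfalso; have := j.2; omega
  have hMr : (M : ℝ) ≠ 0 := by exact_mod_cast hM.ne'
  field_simp

/-- **Plane waves are eigenvectors of the time smoothing**: `Σ_{τ″} W_c(τ,τ″)·e_c(k;(τ″,x⃗)) = w_{k₀}·e_c(k;(τ,x⃗))`. [cite: Salmhofer1999, App. B.5.5] -/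
theorem sum_srcSmoothKernel_mul_hubbardPlaneWave {β : ℝ} (hβ : β ≠ 0) (c : Fin 2) (k : FreqMomentum V M) (τ : ImagTimeIdx M) (x : TorusSite 2 V) :
    ∑ τ' : ImagTimeIdx M, srcSmoothKernel M c τ τ' * hubbardPlaneWave V M β c k (τ', x) =
      ((srcWindowWt M k.1 : ℝ) : ℂ) * hubbardPlaneWave V M β c k (τ, x) := by
  have hM : 0 < M := Nat.pos_of_ne_zero (NeZero.ne M)
  have hMC : ((2 * M : ℕ) : ℂ) ≠ 0 := by exact_mod_cast (show 2 * M ≠ 0 by omega)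
  -- the spatial character (independent of `τ'`)
  set χs : ℂ := (if c = 0 then (starRingEnd ℂ) (torusChar k.2 x) else torusChar k.2 x) with hχs
  have hpw : ∀ τ' : ImagTimeIdx M, hubbardPlaneWave V M β c k (τ', x) =
      Complex.exp (-((chargeSign c * (matsubaraFreq β M k.1 * imagTime β M τ') : ℝ) : ℂ) * Complex.I) * χs := fun τ' =>
    hubbardPlaneWave_eq (L := V) β c k (τ', x)
  -- each summand, expanded over `j`
  have hterm : ∀ τ' : ImagTimeIdx M, srcSmoothKernel M c τ τ' * hubbardPlaneWave V M β c k (τ', x) =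
      ∑ j : MatsubaraIdx M, (((1 / (2 * (M : ℝ)) : ℝ) : ℂ) * ((srcWindowWt M j : ℝ) : ℂ) *
        Complex.exp (-((chargeSign c * (matsubaraFreq β M j * imagTime β M τ) : ℝ) : ℂ) * Complex.I) * χs) *
        Complex.exp (-((chargeSign c * ((matsubaraFreq β M k.1 - matsubaraFreq β M j) * imagTime β M τ') : ℝ) : ℂ) * Complex.I) := by
    intro τ'
    rw [hpw τ', srcSmoothKernel, mul_sum, sum_mul]
    refine sum_congr rfl fun j _ => ?_
    rw [srcSmoothPhase_eq_freq_mul_time hβ]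
    have hexp : Complex.exp (-((chargeSign c * (matsubaraFreq β M j * imagTime β M τ - matsubaraFreq β M j * imagTime β M τ') : ℝ) : ℂ) * Complex.I) *
        Complex.exp (-((chargeSign c * (matsubaraFreq β M k.1 * imagTime β M τ') : ℝ) : ℂ) * Complex.I) =
        Complex.exp (-((chargeSign c * (matsubaraFreq β M j * imagTime β M τ) : ℝ) : ℂ) * Complex.I) *
          Complex.exp (-((chargeSign c * ((matsubaraFreq β M k.1 - matsubaraFreq β M j) * imagTime β M τ') : ℝ) : ℂ) * Complex.I) := by
      rw [← Complex.exp_add, ← Complex.exp_add]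
      congr 1
      push_cast
      ring
    calc ((1 / (2 * (M : ℝ)) : ℝ) : ℂ) * (((srcWindowWt M j : ℝ) : ℂ) *
          Complex.exp (-((chargeSign c * (matsubaraFreq β M j * imagTime β M τ - matsubaraFreq β M j * imagTime β M τ') : ℝ) : ℂ) * Complex.I)) *
          (Complex.exp (-((chargeSign c * (matsubaraFreq β M k.1 * imagTime β M τ') : ℝ) : ℂ) * Complex.I) * χs)
        = ((1 / (2 * (M : ℝ)) : ℝ) : ℂ) * ((srcWindowWt M j : ℝ) : ℂ) * χs *
          (Complex.exp (-((chargeSign c * (matsubaraFreq β M j * imagTime β M τ - matsubaraFreq β M j * imagTime β M τ') : ℝ) : ℂ) * Complex.I) *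
            Complex.exp (-((chargeSign c * (matsubaraFreq β M k.1 * imagTime β M τ') : ℝ) : ℂ) * Complex.I)) := by ring
      _ = _ := by rw [hexp]; ring
  simp_rw [hterm]
  rw [sum_comm]
  simp_rw [← mul_sum, sum_imagTime_cexp hβ c _ k.1]
  -- collapse the `j`-sum at `j = k.1`
  simp_rw [mul_ite, mul_zero]
  rw [Finset.sum_ite_eq univ k.1, if_pos (mem_univ _), hpw τ]
  have h2M : ((1 / (2 * (M : ℝ)) : ℝ) : ℂ) * ((2 * M : ℕ) : ℂ) = 1 := by
    have hMC' : (M : ℂ) ≠ 0 := by exact_mod_cast hM.ne'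
    push_cast
    field_simp
  calc ((1 / (2 * (M : ℝ)) : ℝ) : ℂ) * ((srcWindowWt M k.1 : ℝ) : ℂ) *
        Complex.exp (-((chargeSign c * (matsubaraFreq β M k.1 * imagTime β M τ) : ℝ) : ℂ) * Complex.I) * χs * ((2 * M : ℕ) : ℂ)
      = (((1 / (2 * (M : ℝ)) : ℝ) : ℂ) * ((2 * M : ℕ) : ℂ)) * (((srcWindowWt M k.1 : ℝ) : ℂ) *
        (Complex.exp (-((chargeSign c * (matsubaraFreq β M k.1 * imagTime β M τ) : ℝ) : ℂ) * Complex.I) * χs)) := by ring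
    _ = _ := by rw [h2M, one_mul]

/-- **Smoothing a plain analysis row gives the windowed analysis row**: `Σ_{τ″} W_c(τ,τ″)·E_plain((τ″,x⃗),ℓ;X) = E(F_χ)((τ,x⃗),ℓ;X)` for a slot-`0` leg `ℓ` of
charge `c`. [cite: Salmhofer1999, App. B.5.5] -/
theorem sum_srcSmoothKernel_mul_plainAnalysis {β : ℝ} (hβ : β ≠ 0) (τ : ImagTimeIdx M) (x : TorusSite 2 V) (σ c : Fin 2) (X : HubbardFieldIdx V M) :
    ∑ τ' : ImagTimeIdx M, srcSmoothKernel M c τ τ' * sectorAnalysisMatrix V M β (trivialMultiplier V M) ((τ', x), (((0 : Fin 1), σ), c)) X =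
      sectorAnalysisMatrix V M β (srcWindowFamily V M) ((τ, x), (((0 : Fin 1), σ), c)) X := by
  simp only [sectorAnalysisMatrix, Matrix.of_apply, trivialMultiplier, srcWindowFamily, one_mul]
  by_cases h : X.1.2 = σ ∧ X.2 = c
  · simp_rw [if_pos h]
    rw [← h.2]
    exact sum_srcSmoothKernel_mul_hubbardPlaneWave hβ X.2 X.1.1 τ x
  · simp_rw [if_neg h, mul_zero, sum_const_zero]

/-- **`srcSmoothMat · klSrcAnalysisAt = klSrcAnalysisAtW`.** [cite: Salmhofer1999, App. B.5.5] -/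
theorem srcSmoothMat_mul_klSrcAnalysisAt {β : ℝ} (hβ : β ≠ 0) (μ : ℝ) (K : TrigPolyC4v) (J : ℕ) :
    srcSmoothMat V M J * klSrcAnalysisAt V M β μ K J = klSrcAnalysisAtW V M β μ K J := by
  classical
  ext p' X
  rw [Matrix.mul_apply, klSrcAnalysisAtW_apply]
  by_cases h' : p'.2 = 0
  · -- alive row: identity
    simp_rw [srcSmoothMat_apply_of_alive' p' _ h', ite_mul, one_mul, zero_mul]
    rw [Finset.sum_ite_eq univ p', if_pos (mem_univ _), if_pos h', klSrcAnalysisAt]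
    simp only [Matrix.of_apply, h', if_true]
  · have h1' : p'.2 = 1 := fin_two_eq_one_of_ne_zero' h'
    rw [if_neg h']
    obtain ⟨⟨⟨τ', x'⟩, ℓ'⟩, s'⟩ := p'
    simp only at h' h1' ⊢
    subst h1'
    -- only source columns `q'` with the same site and leg contribute; their analysis rows are plain (slot `0`) or zero
    have hterm : ∀ q' : SrcLabel V M J, srcSmoothMat V M J (((τ', x'), ℓ'), 1) q' * klSrcAnalysisAt V M β μ K J q' X =
        if q'.2 = 1 ∧ q'.1.1.2 = x' ∧ q'.1.2 = ℓ' then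
          (if (ℓ'.1.1 : ℕ) = 0 then srcSmoothKernel M ℓ'.2 τ' q'.1.1.1 *
            sectorAnalysisMatrix V M β (trivialMultiplier V M) ((q'.1.1.1, x'), (((0 : Fin 1), ℓ'.1.2), ℓ'.2)) X else 0)
        else 0 := by
      intro q'
      obtain ⟨⟨⟨qτ, qx⟩, qℓ⟩, qc⟩ := q'
      by_cases hq1 : qc = 1
      · subst hq1
        rw [srcSmoothMat_apply_of_src' J _ _ rfl rfl, klSrcAnalysisAt]
        simp only [Matrix.of_apply]
        rw [if_neg (show ¬ (1 : Fin 2) = 0 by decide)]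
        by_cases hm : x' = qx ∧ ℓ' = qℓ
        · obtain ⟨hx, hl⟩ := hm
          subst hx; subst hl
          rw [if_pos (show x' = x' ∧ ℓ' = ℓ' from ⟨rfl, rfl⟩)]
          simp only [and_self, if_true]
          by_cases hs : (ℓ'.1.1 : ℕ) = 0
          · rw [if_pos hs, if_pos hs]
          · rw [if_neg hs, if_neg hs, mul_zero]
        · rw [if_neg hm, zero_mul]
          simp only [true_and]
          rw [if_neg (fun h : qx = x' ∧ qℓ = ℓ' => hm ⟨h.1.symm, h.2.symm⟩)]
      · have hq0 : qc = 0 := by by_contra h; exact hq1 (fin_two_eq_one_of_ne_zero' h)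
        subst hq0
        rw [srcSmoothMat_offDiag V M J ((τ', x'), ℓ') 1 ((qτ, qx), qℓ) 0 (by decide), zero_mul,
          if_neg (fun h : (0 : Fin 2) = 1 ∧ qx = x' ∧ qℓ = ℓ' => absurd h.1 (by decide))]
    rw [Fintype.sum_congr _ _ hterm]
    by_cases hs : (ℓ'.1.1 : ℕ) = 0
    · simp_rw [if_pos hs]
      obtain ⟨⟨sl, σ'⟩, c'⟩ := ℓ'
      simp only at hs ⊢
      have hsl : sl = ⟨0, by rw [hs.symm]; exact sl.2⟩ := Fin.ext hs
      rw [← sum_srcSmoothKernel_mul_plainAnalysis hβ τ' x' σ' c' X, ← Finset.sum_filter]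
      have hsl0 : (⟨0, by rw [hs.symm]; exact sl.2⟩ : Fin (sectorCount J)) = sl := (Fin.ext hs).symm
      refine Finset.sum_nbij' (fun q' => q'.1.1.1) (fun τ'' => (((τ'', x'), ((sl, σ'), c')), 1)) ?_ ?_ ?_ ?_ ?_
      · intro q' _; exact mem_univ _
      · intro τ'' _
        simp only [mem_filter, mem_univ, and_self]
      · intro q' hq'
        simp only [mem_filter, mem_univ, true_and] at hq'
        obtain ⟨⟨⟨qτ, qx⟩, qℓ⟩, qc⟩ := q'
        simp only at hq' ⊢
        obtain ⟨h1, h2, h3⟩ := hq'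
        subst h1; subst h2; subst h3
        rfl
      · intro τ'' _; rfl
      · intro q' _
        rfl
    · simp_rw [if_neg hs]
      simp

/-- **The smoothed doubled-analysed action is the windowed doubled-analysed action**: `srcSmooth (klSrcActionAt … J n) = map (toLin' klSrcAnalysisAtW_J) 𝒱⁽ⁿ⁾`.
[cite: Salmhofer1999, App. B.2 (B.23)-(B.25)] -/
theorem srcSmooth_klSrcActionAt {β : ℝ} (hβ : β ≠ 0) (U μ : ℝ) (K : TrigPolyC4v) (J n : ℕ) :
    srcSmooth V M J (klSrcActionAt V M β U μ K J n) =
      ExteriorAlgebra.map (Matrix.toLin' (klSrcAnalysisAtW V M β μ K J)) (klEffectiveAction V M β U μ K klE0 n) := by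
  rw [srcSmooth_apply, klSrcActionAt, ← AlgHom.comp_apply, ExteriorAlgebra.map_comp_map, ← Matrix.toLin'_mul,
    srcSmoothMat_mul_klSrcAnalysisAt hβ]

/-- **The smoothed read-out of step `k` is the windowed doubled-analysed action**:
`srcSmooth (klTowerD … k) = map (toLin' (ε • klSrcAnalysisAtW_k)) 𝒱⁽ᵏ⁺¹⁾`. [cite: Salmhofer1999, App. B.2 (B.23)-(B.25)] -/
theorem srcSmooth_klTowerD_eq {β : ℝ} (hβ : β ≠ 0) (U μ : ℝ) (K : TrigPolyC4v) (k : ℕ) :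
    srcSmooth V M k (klTowerD V M β U μ K k) =
      ExteriorAlgebra.map (Matrix.toLin' ((((imagTimeWeight β M : ℝ) : ℂ)) • klSrcAnalysisAtW V M β μ K k))
        (klEffectiveAction V M β U μ K klE0 (k + 1)) := by
  rw [srcSmooth_apply, klTowerD, ← AlgHom.comp_apply, ExteriorAlgebra.map_comp_map, ← Matrix.toLin'_mul, Matrix.mul_smul,
    srcSmoothMat_mul_klSrcAnalysisAt hβ]

/-! ## The base: `srcSmoothMat · klBaseTransfer = klBaseTransferW` -/

section Base

omit [NeZero M] in
/-- **Products of doubled matrices split over the copy index.** [folklore] -/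
theorem sum_srcLabel_eq_sum_copies {n : ℕ} (f : SrcLabel V M n → ℂ) :
    ∑ q : SrcLabel V M n, f q = ∑ y : SpaceTimeIdx V M × SectorLeg (sectorCount n), f (y, 0) + ∑ y : SpaceTimeIdx V M × SectorLeg (sectorCount n), f (y, 1) := by
  rw [Fintype.sum_prod_type, ← Finset.sum_add_distrib]
  refine Finset.sum_congr rfl fun y _ => ?_
  rw [Fin.sum_univ_two]

/-- **The copy-`1` block of the smoothing applied to the plain source block is the windowed source block.** [cite: Salmhofer1999, App. B.5.5] -/
theorem srcSmoothBlock_mul_klSrcPlainBlock {β : ℝ} (hβ : β ≠ 0) :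
    srcSmoothBlock V M 0 * klSrcPlainBlock V M β = klSrcWindowBlock V M β := by
  classical
  ext Y X
  obtain ⟨⟨τ', x'⟩, ⟨⟨sl, σ'⟩, c'⟩⟩ := Y
  rw [Matrix.mul_apply, klSrcWindowBlock]
  simp only [Matrix.of_apply]
  have hterm : ∀ Y' : SpaceTimeIdx V M × SectorLeg (sectorCount 0), srcSmoothBlock V M 0 ((τ', x'), ((sl, σ'), c')) Y' * klSrcPlainBlock V M β Y' X =
      if Y'.1.2 = x' ∧ Y'.2 = ((sl, σ'), c') then
        (if (sl : ℕ) = 0 then (((imagTimeWeight β M : ℝ) : ℂ)) * (srcSmoothKernel M c' τ' Y'.1.1 *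
          sectorAnalysisMatrix V M β (trivialMultiplier V M) ((Y'.1.1, x'), (((0 : Fin 1), σ'), c')) X) else 0)
      else 0 := by
    intro Y'
    obtain ⟨⟨yτ, yx⟩, yℓ⟩ := Y'
    rw [srcSmoothBlock, srcSmoothMat_apply_of_src' 0 _ _ rfl rfl, klSrcPlainBlock]
    simp only [Matrix.of_apply]
    by_cases hm : x' = yx ∧ ((sl, σ'), c') = yℓ
    · obtain ⟨hx, hl⟩ := hm
      subst hx; subst hl
      rw [if_pos (show x' = x' ∧ ((sl, σ'), c') = ((sl, σ'), c') from ⟨rfl, rfl⟩), if_pos (show x' = x' ∧ ((sl, σ'), c') = ((sl, σ'), c') from ⟨rfl, rfl⟩)]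
      simp only
      by_cases hs : (sl : ℕ) = 0
      · rw [if_pos hs, if_pos hs]; ring
      · rw [if_neg hs, if_neg hs, mul_zero]
    · rw [if_neg hm, zero_mul, if_neg (fun h : yx = x' ∧ yℓ = ((sl, σ'), c') => hm ⟨h.1.symm, h.2.symm⟩)]
  rw [Fintype.sum_congr _ _ hterm]
  by_cases hs : (sl : ℕ) = 0
  · simp_rw [if_pos hs]
    rw [← sum_srcSmoothKernel_mul_plainAnalysis hβ τ' x' σ' c' X, Finset.mul_sum, ← Finset.sum_filter]
    refine Finset.sum_nbij' (fun Y' => Y'.1.1) (fun τ'' => ((τ'', x'), ((sl, σ'), c'))) ?_ ?_ ?_ ?_ ?_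
    · intro Y' _; exact mem_univ _
    · intro τ'' _
      simp only [mem_filter, mem_univ, and_self]
    · intro Y' hY'
      simp only [mem_filter, mem_univ, true_and] at hY'
      obtain ⟨⟨yτ, yx⟩, yℓ⟩ := Y'
      simp only at hY' ⊢
      obtain ⟨h1, h2⟩ := hY'
      subst h1; subst h2
      rfl
    · intro τ'' _; rfl
    · intro Y' _; rfl
  · simp_rw [if_neg hs]
    simp

/-- **`srcSmoothMat · klBaseTransfer = klBaseTransferW`.** [cite: Salmhofer1999, App. B.5.5] -/
theorem srcSmoothMat_mul_klBaseTransfer {β : ℝ} (hβ : β ≠ 0) (μ : ℝ) (K : TrigPolyC4v) :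
    srcSmoothMat V M 0 * klBaseTransfer V M β μ K = klBaseTransferW V M β μ K := by
  classical
  ext p' p
  obtain ⟨x', s'⟩ := p'
  obtain ⟨z, t⟩ := p
  rw [Matrix.mul_apply, sum_srcLabel_eq_sum_copies, klBaseTransferW]
  simp only [Matrix.of_apply]
  by_cases hs' : s' = 0
  · subst hs'
    -- alive row: `S = 𝟙` on copy 0, `0` against copy 1
    have h0 : ∀ y : SpaceTimeIdx V M × SectorLeg (sectorCount 0), srcSmoothMat V M 0 (x', 0) (y, 0) * klBaseTransfer V M β μ K (y, 0) (z, t) =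
        if y = x' then klBaseTransfer V M β μ K (x', 0) (z, t) else 0 := by
      intro y
      rw [srcSmoothMat_apply_of_alive' (x', (0 : Fin 2)) (y, 0) rfl]
      by_cases hy : y = x'
      · subst hy; rw [if_pos rfl, if_pos rfl, one_mul]
      · rw [if_neg (fun h => hy (Prod.ext_iff.mp h).1.symm), if_neg hy, zero_mul]
    have h1 : ∀ y : SpaceTimeIdx V M × SectorLeg (sectorCount 0), srcSmoothMat V M 0 (x', 0) (y, 1) * klBaseTransfer V M β μ K (y, 1) (z, t) = 0 := by
      intro y
      rw [srcSmoothMat_offDiag V M 0 x' 0 y 1 (by decide), zero_mul]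
    rw [Fintype.sum_congr _ _ h0, Fintype.sum_congr _ _ h1, Fintype.sum_ite_eq', Finset.sum_const_zero, add_zero, klBaseTransfer_apply]
    dsimp only
    by_cases ht : t = 0
    · subst ht; rw [if_pos ⟨rfl, rfl⟩, if_pos ⟨rfl, rfl⟩]
    · have hP2 : ¬((0 : Fin 2) = 1 ∧ t = 1) := fun h => absurd h.1 (by decide)
      simp only [ht, hP2, if_false, and_false]
  · have hs1 : s' = 1 := fin_two_eq_one_of_ne_zero' hs'
    subst hs1
    have h0 : ∀ y : SpaceTimeIdx V M × SectorLeg (sectorCount 0), srcSmoothMat V M 0 (x', 1) (y, 0) * klBaseTransfer V M β μ K (y, 0) (z, t) = 0 := by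
      intro y
      rw [srcSmoothMat_offDiag V M 0 x' 1 y 0 (by decide), zero_mul]
    rw [Fintype.sum_congr _ _ h0, Finset.sum_const_zero, zero_add]
    rw [if_neg (show ¬((1 : Fin 2) = 0 ∧ t = 0) from fun h => absurd h.1 (by decide))]
    by_cases ht : t = 1
    · subst ht
      rw [if_pos (show (1 : Fin 2) = 1 ∧ (1 : Fin 2) = 1 from ⟨rfl, rfl⟩), ← srcSmoothBlock_mul_klSrcPlainBlock hβ, Matrix.mul_assoc, Matrix.mul_apply]
      refine Finset.sum_congr rfl fun y _ => ?_
      rw [klBaseTransfer_apply, if_neg (show ¬((1 : Fin 2) = 0 ∧ (1 : Fin 2) = 0) from fun h => absurd h.1 (by decide)),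
        if_pos (show (1 : Fin 2) = 1 ∧ (1 : Fin 2) = 1 from ⟨rfl, rfl⟩)]
      rfl
    · have ht0 : t = 0 := by by_contra h; exact ht (fin_two_eq_one_of_ne_zero' h)
      subst ht0
      rw [if_neg (show ¬((1 : Fin 2) = 1 ∧ (0 : Fin 2) = 1) from fun h => absurd h.2 (by decide))]
      refine Finset.sum_eq_zero fun y _ => ?_
      rw [klBaseTransfer_apply, if_neg (show ¬((1 : Fin 2) = 0 ∧ (0 : Fin 2) = 0) from fun h => absurd h.1 (by decide)),
        if_neg (show ¬((1 : Fin 2) = 1 ∧ (0 : Fin 2) = 1) from fun h => absurd h.2 (by decide)), mul_zero]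

/-- **THE SMOOTHED BASE IDENTITY**: `srcSmooth (klTowerD … 0) = map (toLin' klBaseTransferW) (map (toLin' klDoubleOne) klGridAction)`.
[cite: BenfattoGiulianiMastropietro2006, §2.7 (2.70)-(2.71)] -/
theorem srcSmooth_klTowerD_zero {β : ℝ} (hβ : β ≠ 0) (U μ : ℝ) (K : TrigPolyC4v) :
    srcSmooth V M 0 (klTowerD V M β U μ K 0) = ExteriorAlgebra.map (Matrix.toLin' (klBaseTransferW V M β μ K))
      (ExteriorAlgebra.map (Matrix.toLin' (klDoubleOne V (klGridN M))) (klGridAction V M β U μ K)) := by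
  rw [srcSmooth_apply, klTowerD_zero_eq_map_klBaseTransfer hβ, ← AlgHom.comp_apply, ExteriorAlgebra.map_comp_map, ← Matrix.toLin'_mul,
    srcSmoothMat_mul_klBaseTransfer hβ]

end Base

end Summit.HubbardSuperconductivity.HubbardSuperconductivity.Theorems.TwoVolumeSource

end
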